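import Summits.BirchSwinnertonDyer.BirchSwinnertonDyer.Theorems.GenusKolyvaginAtTwoGenusPrimitiveSupplyAtTwoLevelOneTower
import Summits.BirchSwinnertonDyer.BirchSwinnertonDyer.Theorems.GenusKolyvaginAtTwoGenusPrimitiveSupplyAtTwoGenusComponents

/-!
# Route `GenusKolyvaginAtTwo`, crux `GenusPrimitiveSupplyAtTwo` (stmt-BirchSwinnertonDyer-22136), line `genus-supply`:
# genus-character components ALONG THE TOWER `K[m] ⊆ K[n]` — fibre decomposition of `Y_M^{(n)}` along `res : 𝒢_n ↠ 𝒢_m`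

Lead prover seat bsd-line-gk2-p1 (g3). Groundwork for the norm-relation reading `Y_M^{(n)} = A(n/m)·Y_m′` of the genus-character
components (`…GenusComponents`), which is what turns the BSD-side valuations of the genus Heegner indices at their OWN levels
(U-LEDGER (♣)) into the hypotheses of the (R1)/(R2) mechanisms at level `n`. This file does the GROUP-THEORETIC half:
* §1 (abstract) the orbit sum over a fibre of a homomorphism is the translate of the orbit sum over the kernel:
  `Σ_{g ∈ G, r g = r g₀} g·P = g₀·(Σ_{k ∈ ker} k·P)`; and a character sum whose character factors through `r` decomposes over the
  fibres: `Σ_{g∈G} w(r g)·g·P = Σ_{t} w(t)·(lift t)·(Σ_{k∈ker} k·P)`;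
* §2 (Heegner frame, `m ∣ n`) genus radicals are compatible with restriction: for `θ ∈ K[n]`, `θ′ ∈ K[m]` with the same rational square,
  `g θ = θ ↔ (res g) θ′ = θ′` — so the genus characters `χ_M^{(n)}`, `M ⊆ {ℓ ∣ m}`, factor through `res : 𝒢_n → 𝒢_m`;
* §3 hence **`Y_M^{(n)} = Σ_{t ∈ 𝒢_m} χ_M^{(m)}(t)·g_t·Tr_{K[n]/K[m]} y(n)`** (`g_t` any lift of `t`, `Tr = Σ_{k ∈ Gal(K[n]/K[m])} k·`), the
  component at level `n` as a twisted sum of translates of the relative trace. The remaining ANALYTIC half — the multi-prime norm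
  relation `Tr_{K[n]/K[m]} y(n) = (∏_{ℓ∣n/m} a_ℓ)·y(m)′` (Gross 1991 Prop. 3.7 (1) iterated; the tree has the one-prime step
  `HeegnerTrace.finsum_mem_ringClassGalOver_eq_frobeniusTrace_smul`) — is left to a successor.
Helper (`--supports stmt-BirchSwinnertonDyer-22136`); BSD is not proved by any of this.
-/

set_option linter.dupNamespace false -- tree convention: `Summit.BirchSwinnertonDyer.BirchSwinnertonDyer.Theorems` (summit = sub-problem)

noncomputable section

open scoped Classical

namespace Summit.BirchSwinnertonDyer.BirchSwinnertonDyer.Theorems.GenusKoly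

open Finset NumberField WeierstrassCurve Literature.NumberTheory.EllipticCurves
  Literature.NumberTheory.EllipticCurves.ModularForms Summit.BirchSwinnertonDyer.Rank1Residual.X11b

/-! ## §1 Abstract: orbit sums over fibres of a homomorphism -/

section Fibre

variable {𝒢 ℋ : Type*} [Group 𝒢] [Group ℋ] {A : Type*} [AddCommGroup A]

/-- **Orbit sum over a fibre = translate of the orbit sum over the kernel.** For a subgroup `S ≤ 𝒢` enumerated by a finite `G`, a
homomorphism `r : S → ℋ` (extended by `1` off `S`), `g₀ ∈ S` and a point `P`:
`Σ_{g ∈ G, r g = r g₀} g·P = g₀ · Σ_{k ∈ G, r k = 1} k·P` (the fibre is the coset `g₀ · ker r`). [folklore] -/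
theorem sum_filter_fibre_eq_act_sum_ker (act : 𝒢 →* AddMonoid.End A) (S : Subgroup 𝒢) (r : S →* ℋ) (G : Finset 𝒢)
    (hG : ∀ g, g ∈ G ↔ g ∈ S) {g₀ : 𝒢} (hg₀ : g₀ ∈ S) (P : A) :
    ∑ g ∈ G.filter (fun g ↦ (if hg : g ∈ S then r ⟨g, hg⟩ else 1) = r ⟨g₀, hg₀⟩), act g P =
      act g₀ (∑ k ∈ G.filter (fun k ↦ (if hk : k ∈ S then r ⟨k, hk⟩ else 1) = 1), act k P) := by
  rw [map_sum]
  symm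
  refine Finset.sum_nbij (fun k ↦ g₀ * k) (fun k hk ↦ ?_) (fun a ha b hb hab ↦ mul_left_cancel hab) (fun g hg ↦ ?_)
    (fun k hk ↦ ?_)
  · -- into the fibre
    simp only [Finset.mem_filter] at hk ⊢
    obtain ⟨hkG, hk1⟩ := hk
    have hkS : k ∈ S := (hG k).mp hkG
    have hS : g₀ * k ∈ S := S.mul_mem hg₀ hkS
    refine ⟨(hG _).mpr hS, ?_⟩
    rw [dif_pos hkS] at hk1
    rw [dif_pos hS, show (⟨g₀ * k, hS⟩ : S) = ⟨g₀, hg₀⟩ * ⟨k, hkS⟩ from rfl, map_mul, hk1, mul_one]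
  · -- onto the fibre
    simp only [Finset.mem_coe, Finset.mem_filter] at hg
    obtain ⟨hgG, hgr⟩ := hg
    have hgS : g ∈ S := (hG g).mp hgG
    rw [dif_pos hgS] at hgr
    have hkS : g₀⁻¹ * g ∈ S := S.mul_mem (S.inv_mem hg₀) hgS
    refine ⟨g₀⁻¹ * g, ?_, mul_inv_cancel_left g₀ g⟩
    simp only [Finset.mem_coe, Finset.mem_filter]
    refine ⟨(hG _).mpr hkS, ?_⟩
    rw [dif_pos hkS, show (⟨g₀⁻¹ * g, hkS⟩ : S) = ⟨g₀, hg₀⟩⁻¹ * ⟨g, hgS⟩ from rfl, map_mul, map_inv, hgr, inv_mul_cancel]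
  · -- summand
    rw [map_mul]
    rfl

/-- **A character sum whose character factors through `r` decomposes over the fibres.** With `S`, `r`, `G` as above, a finite `H`
containing `r(S ∩ G)`, a lift `lift t ∈ S` with `r (lift t) = t` for `t ∈ H`, and weights `w : ℋ → ℤ`:
`Σ_{g ∈ G} w(r g)·g·P = Σ_{t ∈ H} w(t)·(lift t)·(Σ_{k ∈ ker} k·P)`. [folklore] -/
theorem sum_weight_restrict_eq_sum_fibres (act : 𝒢 →* AddMonoid.End A) (S : Subgroup 𝒢) (r : S →* ℋ) (G : Finset 𝒢)
    (hG : ∀ g, g ∈ G ↔ g ∈ S) (H : Finset ℋ) (hH : ∀ g (hg : g ∈ S), g ∈ G → r ⟨g, hg⟩ ∈ H)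
    (lift : ℋ → 𝒢) (hliftS : ∀ t ∈ H, lift t ∈ S) (hlift : ∀ t (ht : t ∈ H), r ⟨lift t, hliftS t ht⟩ = t)
    (w : ℋ → ℤ) (P : A) :
    ∑ g ∈ G, w (if hg : g ∈ S then r ⟨g, hg⟩ else 1) • act g P =
      ∑ t ∈ H, w t • act (lift t) (∑ k ∈ G.filter (fun k ↦ (if hk : k ∈ S then r ⟨k, hk⟩ else 1) = 1), act k P) := by
  rw [← Finset.sum_fiberwise_of_maps_to (s := G) (t := H) (g := fun g ↦ if hg : g ∈ S then r ⟨g, hg⟩ else 1)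
    (fun g hgG ↦ by rw [dif_pos ((hG g).mp hgG)]; exact hH g ((hG g).mp hgG) hgG)]
  refine Finset.sum_congr rfl fun t ht ↦ ?_
  have hfib : ∀ g ∈ G.filter (fun g ↦ (if hg : g ∈ S then r ⟨g, hg⟩ else 1) = t),
      w (if hg : g ∈ S then r ⟨g, hg⟩ else 1) • act g P = w t • act g P := fun g hg ↦ by
    rw [(Finset.mem_filter.mp hg).2]
  rw [Finset.sum_congr rfl hfib, ← Finset.smul_sum]
  congr 1
  have hfilt : G.filter (fun g ↦ (if hg : g ∈ S then r ⟨g, hg⟩ else 1) = t) =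
      G.filter (fun g ↦ (if hg : g ∈ S then r ⟨g, hg⟩ else 1) = r ⟨lift t, hliftS t ht⟩) :=
    Finset.filter_congr fun g _ ↦ by rw [hlift t ht]
  rw [hfilt]
  exact sum_filter_fibre_eq_act_sum_ker act S r G hG (hliftS t ht) P

end Fibre

/-! ## §2 The Heegner frame: genus radicals and genus characters are compatible with restriction along `K[m] ⊆ K[n]` -/

section Heegner

variable {W : WeierstrassCurve ℚ} [NeZero (W.conductorNorm ℤ)] {K : Type} [Field K] [NumberField K]
  {Dt : ModularParametrizationData W (W.conductorNorm ℤ)} {β : ℤ} {ι : K →+* ℂ}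

omit [NeZero (W.conductorNorm ℤ)] in
/-- A rational number read in a ring class field and then in `ℂ` is itself. [folklore] -/
theorem heegner_coe_algebraMap_rat (n : ℕ) (q : ℚ) : ((algebraMap ℚ (ringClassField K ι n) q : ringClassField K ι n) : ℂ) = q := by
  rw [eq_ratCast (algebraMap ℚ (ringClassField K ι n)) q, SubfieldClass.coe_ratCast]

omit [NeZero (W.conductorNorm ℤ)] in
/-- **Genus radicals are compatible with restriction**: for `m ∣ n`, `θ ∈ K[n]` and `θ′ ∈ K[m]` with the same rational square (the two
readings of `√ℓ*`), and `g ∈ 𝒢_n` with restriction `res g ∈ Aut(K[m])` (value formula): `g θ = θ ↔ (res g) θ′ = θ′`. So the genus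
characters `χ_M`, `M ⊆ {ℓ ∣ m}`, of level `n` factor through `res : 𝒢_n → 𝒢_m`. [cite: GrossLMS1991, §3 (p. 216)] [cite: Cox2013, Thm. 9.18] -/
theorem heegner_fix_iff_restrict_fix (hK : IsImaginaryQuadratic K) {m n : ℕ} (hmn : m ∣ n) (hn : n ≠ 0)
    {res : ringClassGal ι n →* (ringClassField K ι m ≃ₐ[ℚ] ringClassField K ι m)}
    (hres : ∀ (g : ringClassGal ι n) (x : ringClassField K ι m) (y : ringClassField K ι n), (x : ℂ) = (y : ℂ) →
      ((res g x : ringClassField K ι m) : ℂ) = (((g : ringClassField K ι n ≃ₐ[ℚ] ringClassField K ι n) y : ringClassField K ι n) : ℂ))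
    {θ : ringClassField K ι n} {θ' : ringClassField K ι m} {q : ℚ}
    (hθ : θ ^ 2 = algebraMap ℚ (ringClassField K ι n) q) (hθ' : θ' ^ 2 = algebraMap ℚ (ringClassField K ι m) q)
    (g : ringClassGal ι n) :
    (g : ringClassField K ι n ≃ₐ[ℚ] ringClassField K ι n) θ = θ ↔ res g θ' = θ' := by
  obtain ⟨y, hy⟩ := RingClassTower.exists_coe_eq_of_dvd hK ι hmn hn θ'
  have hy2 : y ^ 2 = θ ^ 2 := by
    rw [hθ]
    apply Subtype.ext
    rw [SubmonoidClass.coe_pow, ← hy, ← SubmonoidClass.coe_pow, hθ', heegner_coe_algebraMap_rat, heegner_coe_algebraMap_rat]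
  have hval : res g θ' = θ' ↔ (g : ringClassField K ι n ≃ₐ[ℚ] ringClassField K ι n) y = y := by
    rw [Subtype.ext_iff, Subtype.ext_iff, hres g θ' y hy, hy]
  rw [hval]
  rcases sq_eq_sq_iff_eq_or_eq_neg.mp hy2 with h | h
  · rw [h]
  · rw [h, map_neg, neg_inj]

omit [NeZero (W.conductorNorm ℤ)] in
/-- The product of signs over `M` factors through `res` (from `heegner_fix_iff_restrict_fix`, prime by prime). [folklore] -/
theorem heegner_prod_sign_eq_prod_sign_restrict (hK : IsImaginaryQuadratic K) {m n : ℕ} (hmn : m ∣ n) (hn : n ≠ 0)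
    {res : ringClassGal ι n →* (ringClassField K ι m ≃ₐ[ℚ] ringClassField K ι m)}
    (hres : ∀ (g : ringClassGal ι n) (x : ringClassField K ι m) (y : ringClassField K ι n), (x : ℂ) = (y : ℂ) →
      ((res g x : ringClassField K ι m) : ℂ) = (((g : ringClassField K ι n ≃ₐ[ℚ] ringClassField K ι n) y : ringClassField K ι n) : ℂ))
    {θ : ℕ → ringClassField K ι n} {θ' : ℕ → ringClassField K ι m} {M : Finset ℕ}
    (hθ : ∀ ℓ ∈ M, θ ℓ ^ 2 = algebraMap ℚ (ringClassField K ι n) ((-1 : ℚ) ^ (ℓ / 2) * ℓ))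
    (hθ' : ∀ ℓ ∈ M, θ' ℓ ^ 2 = algebraMap ℚ (ringClassField K ι m) ((-1 : ℚ) ^ (ℓ / 2) * ℓ)) (g : ringClassGal ι n) :
    (∏ ℓ ∈ M, (if (g : ringClassField K ι n ≃ₐ[ℚ] ringClassField K ι n) (θ ℓ) = θ ℓ then (1 : ℤ) else -1)) =
      ∏ ℓ ∈ M, (if res g (θ' ℓ) = θ' ℓ then (1 : ℤ) else -1) := by
  refine Finset.prod_congr rfl fun ℓ hℓ ↦ ?_
  have key := heegner_fix_iff_restrict_fix hK hmn hn hres (hθ ℓ hℓ) (hθ' ℓ hℓ) g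
  by_cases h : (g : ringClassField K ι n ≃ₐ[ℚ] ringClassField K ι n) (θ ℓ) = θ ℓ
  · rw [if_pos h, if_pos (key.mp h)]
  · rw [if_neg h, if_neg (mt key.mpr h)]

/-! ## §3 `Y_M^{(n)}` as a twisted sum of translates of the relative trace `Tr_{K[n]/K[m]} y(n)` -/

omit [NeZero (W.conductorNorm ℤ)] in
/-- **The kernel of `res` inside `G`: `res g = 1 ↔ g ∈ Gal(K[n]/K[m])`** (`restrictHom_eq_one_of_mem`, `mem_ringClassGalOver_of_restrictHom_mem`).
[cite: GrossLMS1991, §3 (p. 216)] -/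
theorem heegner_filter_restrict_eq_one_eq (hK : IsImaginaryQuadratic K) {m n : ℕ} (hmn : m ∣ n) (hn : n ≠ 0)
    {res : ringClassGal ι n →* (ringClassField K ι m ≃ₐ[ℚ] ringClassField K ι m)}
    (hres : ∀ (g : ringClassGal ι n) (x : ringClassField K ι m) (y : ringClassField K ι n), (x : ℂ) = (y : ℂ) →
      ((res g x : ringClassField K ι m) : ℂ) = (((g : ringClassField K ι n ≃ₐ[ℚ] ringClassField K ι n) y : ringClassField K ι n) : ℂ))
    (G : Finset (ringClassField K ι n ≃ₐ[ℚ] ringClassField K ι n)) (hG : ∀ g, g ∈ G ↔ g ∈ ringClassGal ι n) :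
    G.filter (fun k ↦ (if hk : k ∈ ringClassGal ι n then res ⟨k, hk⟩ else 1) = 1) =
      G.filter (fun k ↦ k ∈ ringClassGalOver ι n m) := by
  refine Finset.filter_congr fun k hk ↦ ?_
  have hkS : k ∈ ringClassGal ι n := (hG k).mp hk
  rw [dif_pos hkS]
  constructor
  · intro h1
    exact RingClassTower.mem_ringClassGalOver_of_restrictHom_mem ι hres le_rfl ⟨k, hkS⟩ (by rw [h1]; exact one_mem _)
  · intro hk'
    exact RingClassTower.restrictHom_eq_one_of_mem hK ι hmn hn hres ⟨k, hkS⟩ hk'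

/-- **`Y_M^{(n)} = Σ_{t ∈ 𝒢_m} χ_M^{(m)}(t) · g_t · Tr_{K[n]/K[m]} y(n)`** — the genus-character component at level `n` (`M ⊆ {ℓ ∣ m}`,
`m ∣ n`) decomposed along `res : 𝒢_n ↠ 𝒢_m`: `G`, `Gm` enumerate `𝒢_n`, `𝒢_m`; `θ`, `θ′` the radicals `√ℓ*` read in `K[n]`,
`K[m]`; `lift` any section of `res` on `𝒢_m`; the inner sum runs over `Gal(K[n]/K[m])`. What remains for the norm-relation reading
`Y_M^{(n)} = A(n/m)·Y_m′` is the multi-prime trace `Σ_{k ∈ Gal(K[n]/K[m])} k·y(n) = A(n/m)·y(m)′` and `g_t·y(m)′ = (t·y(m))′`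
(`…LevelOneTower` §1). [cite: GrossLMS1991, §3 (3.5), Prop. 3.7 (1), §4 (4.1)] -/
theorem heegner_genusComponent_eq_sum_restrict (hK : IsImaginaryQuadratic K) {m n : ℕ} (hmn : m ∣ n) (hn : n ≠ 0)
    {res : ringClassGal ι n →* (ringClassField K ι m ≃ₐ[ℚ] ringClassField K ι m)}
    (hres : ∀ (g : ringClassGal ι n) (x : ringClassField K ι m) (y : ringClassField K ι n), (x : ℂ) = (y : ℂ) →
      ((res g x : ringClassField K ι m) : ℂ) = (((g : ringClassField K ι n ≃ₐ[ℚ] ringClassField K ι n) y : ringClassField K ι n) : ℂ))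
    (d : KolyvaginHeegnerData Dt β ι n) {θ : ℕ → ringClassField K ι n} {θ' : ℕ → ringClassField K ι m} {M : Finset ℕ}
    (hθ : ∀ ℓ ∈ M, θ ℓ ^ 2 = algebraMap ℚ (ringClassField K ι n) ((-1 : ℚ) ^ (ℓ / 2) * ℓ))
    (hθ' : ∀ ℓ ∈ M, θ' ℓ ^ 2 = algebraMap ℚ (ringClassField K ι m) ((-1 : ℚ) ^ (ℓ / 2) * ℓ))
    (G : Finset (ringClassField K ι n ≃ₐ[ℚ] ringClassField K ι n)) (hG : ∀ g, g ∈ G ↔ g ∈ ringClassGal ι n)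
    (Gm : Finset (ringClassField K ι m ≃ₐ[ℚ] ringClassField K ι m)) (hGm : ∀ t, t ∈ Gm ↔ t ∈ ringClassGal ι m)
    (lift : (ringClassField K ι m ≃ₐ[ℚ] ringClassField K ι m) → (ringClassField K ι n ≃ₐ[ℚ] ringClassField K ι n))
    (hliftS : ∀ t ∈ Gm, lift t ∈ ringClassGal ι n) (hlift : ∀ t (ht : t ∈ Gm), res ⟨lift t, hliftS t ht⟩ = t) :
    ∑ g ∈ G, (∏ ℓ ∈ M, (if g (θ ℓ) = θ ℓ then (1 : ℤ) else -1)) • pointGalHom W (ringClassField K ι n) g d.y =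
      ∑ t ∈ Gm, (∏ ℓ ∈ M, (if t (θ' ℓ) = θ' ℓ then (1 : ℤ) else -1)) •
        pointGalHom W (ringClassField K ι n) (lift t)
          (∑ k ∈ G.filter (fun k ↦ k ∈ ringClassGalOver ι n m), pointGalHom W (ringClassField K ι n) k d.y) := by
  -- the level-`n` character is the level-`m` character of the restriction
  have hchar : ∀ g ∈ G, (∏ ℓ ∈ M, (if g (θ ℓ) = θ ℓ then (1 : ℤ) else -1)) =
      (fun t : ringClassField K ι m ≃ₐ[ℚ] ringClassField K ι m ↦ ∏ ℓ ∈ M, (if t (θ' ℓ) = θ' ℓ then (1 : ℤ) else -1))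
        (if hg : g ∈ ringClassGal ι n then res ⟨g, hg⟩ else 1) := fun g hg ↦ by
    have hgS : g ∈ ringClassGal ι n := (hG g).mp hg
    simp only [dif_pos hgS]
    exact heegner_prod_sign_eq_prod_sign_restrict hK hmn hn hres hθ hθ' ⟨g, hgS⟩
  rw [Finset.sum_congr rfl (fun g hg ↦ by rw [hchar g hg]), ← heegner_filter_restrict_eq_one_eq hK hmn hn hres G hG]
  exact sum_weight_restrict_eq_sum_fibres (pointGalHom W (ringClassField K ι n)) (ringClassGal ι n) res G hG Gm
    (fun g hg _ ↦ (hGm _).mpr (RingClassTower.restrictHom_mem_ringClassGal ι hres ⟨g, hg⟩)) lift hliftS hlift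
    (fun t ↦ ∏ ℓ ∈ M, (if t (θ' ℓ) = θ' ℓ then (1 : ℤ) else -1)) d.y

/-- **A section of `res` on `𝒢_m` exists** (`res` is onto: `RingClassTower.exists_restrictHom_eq`). [cite: GrossLMS1991, §3 (p. 216), §4] -/
theorem heegner_exists_lift (hK : IsImaginaryQuadratic K) {m n : ℕ} (hmn : m ∣ n) (hn : n ≠ 0)
    {res : ringClassGal ι n →* (ringClassField K ι m ≃ₐ[ℚ] ringClassField K ι m)}
    (hres : ∀ (g : ringClassGal ι n) (x : ringClassField K ι m) (y : ringClassField K ι n), (x : ℂ) = (y : ℂ) →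
      ((res g x : ringClassField K ι m) : ℂ) = (((g : ringClassField K ι n ≃ₐ[ℚ] ringClassField K ι n) y : ringClassField K ι n) : ℂ))
    (Gm : Finset (ringClassField K ι m ≃ₐ[ℚ] ringClassField K ι m)) (hGm : ∀ t, t ∈ Gm ↔ t ∈ ringClassGal ι m) :
    ∃ lift : (ringClassField K ι m ≃ₐ[ℚ] ringClassField K ι m) → (ringClassField K ι n ≃ₐ[ℚ] ringClassField K ι n),
      ∃ hliftS : ∀ t ∈ Gm, lift t ∈ ringClassGal ι n, ∀ t (ht : t ∈ Gm), res ⟨lift t, hliftS t ht⟩ = t := by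
  have key : ∀ t : ringClassField K ι m ≃ₐ[ℚ] ringClassField K ι m, ∃ g : ringClassField K ι n ≃ₐ[ℚ] ringClassField K ι n,
      t ∈ ringClassGal ι m → ∃ hg : g ∈ ringClassGal ι n, res ⟨g, hg⟩ = t := by
    intro t
    by_cases ht : t ∈ ringClassGal ι m
    · obtain ⟨g, hg⟩ := RingClassTower.exists_restrictHom_eq hK ι hmn hn hres ht
      exact ⟨g, fun _ ↦ ⟨g.2, hg⟩⟩
    · exact ⟨1, fun h ↦ absurd h ht⟩
  choose lift hlift using key
  exact ⟨lift, fun t ht ↦ (hlift t ((hGm t).mp ht)).1, fun t ht ↦ (hlift t ((hGm t).mp ht)).2⟩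

end Heegner

end Summit.BirchSwinnertonDyer.BirchSwinnertonDyer.Theorems.GenusKoly

end
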